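import Summits.MatrixMultiplication.MatrixMultiplication.Theorems.LevelGradedCohnUmansLieRankDesignsStubOracleSound

/-!
# Crux `LevelOneGL2Designs` (stmt-MatrixMultiplication-14080), certified-compute lane:
the checker of integer LEVEL-ONE SEPARATION CERTIFICATES (soundness, kernel-checked)

Infrastructure of the certified-compute seat (`refuter-ccert-stmt-MatrixMultiplication-14080-0`).
No theorem asserts a Theses statement positively and no `Prop` is postulated: the checker turns a
finite table of integers into the `RankSep 1 X Y Z` clause of the crux for ONE explicit triple, so
that the EXISTENCE side of every finite window (`(|X|,|Y|,|Z|)` achieved at a given prime `p`) is a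
`native_decide` evaluation of a `Bool` (`fastCheck … = true`) followed by `rankSep_one_of_fastCheck`.

Certificate format (produced off-box by exact rational linear algebra, `lvl1/core.py`,
`solve_certificate`): for each target `(x₀, z₀) ∈ X × Z` a nonzero integer `N` and a list of
entries `(u, v, a)` (`u, v ∈ 𝔽_p^m`, `a ∈ ℤ`), read as the integer-valued FRAME FUNCTION
`F(g) = Σ_{(u,v,a)} a·[g u = v]` (`certVal`).  The check is that on every quadruple product
`q = x⁻¹ y y'⁻¹ z` of the triple, `F(q) = N·[x = x₀ ∧ y = y' ∧ z = z₀]`.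
Soundness (`sep_target_of_cert`, `rankSep_one_of_cert`): every entry function `g ↦ [g u = v]` lies
in `F_1|_G` (`OracleSound.entry_mem_levelSubmodule`, from stub K `stub_frameFnLevel`: Fourier
inversion on `𝔽_p^m`), `F_1|_G = levelSubmodule p m 1` is a submodule, so `N⁻¹·F ∈ F_1|_G` is
`fourierFn c` for a rank-`≤ 1` table `c` (`mem_levelSubmodule_iff`) and separates the target.
The FAST LANE (`M2`, `fastCheck`, `rankSep_one_of_fastCheck`) restates everything for `GL_2(𝔽_p)`
over concrete 4-tuples so that the compiled evaluation is cheap (Mathlib matrices are closures).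
-/

set_option linter.dupNamespace false

namespace Summit.MatrixMultiplication.MatrixMultiplication.Theorems.LevelOneGL2Designs.Negative

open Summit.MatrixMultiplication.MatrixMultiplication.Theorems.LieRankDesigns.Negative
open Summit.MatrixMultiplication.MatrixMultiplication.Theorems.LieRankDesigns.OracleSound
  (entry_mem_levelSubmodule)

section Generic

variable {p m : ℕ}

/-- One entry `(u, v, a)` of a level-one certificate: contributes `a·[g u = v]`. -/
abbrev CertEntry (p m : ℕ) : Type := (Fin m → ZMod p) × (Fin m → ZMod p) × ℤ

/-- The integer frame function of a certificate list: `certVal L g = Σ_{(u,v,a) ∈ L} a·[g u = v]`. -/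
def certVal (L : List (CertEntry p m)) (g : Mat p m) : ℤ :=
  (L.map fun e => if g.mulVec e.1 = e.2.1 then e.2.2 else 0).sum

/-- The empty certificate is the zero function. -/
@[simp] theorem certVal_nil (g : Mat p m) : certVal ([] : List (CertEntry p m)) g = 0 := rfl

/-- Unfolding one entry of a certificate. -/
@[simp] theorem certVal_cons (e : CertEntry p m) (L : List (CertEntry p m)) (g : Mat p m) :
    certVal (e :: L) g = (if g.mulVec e.1 = e.2.1 then e.2.2 else 0) + certVal L g := by
  simp [certVal]

variable [Fact p.Prime]

/-- The complex-valued frame function of a certificate list lies in `F_1|_G`. -/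
theorem certVal_mem_levelSubmodule (L : List (CertEntry p m)) :
    (fun g : GLm p m => (certVal L (g : Mat p m) : ℂ)) ∈ levelSubmodule p m 1 := by
  induction L with
  | nil =>
    have h0 : (fun g : GLm p m => (certVal ([] : List (CertEntry p m)) (g : Mat p m) : ℂ)) = 0 := by
      funext g; simp
    rw [h0]; exact Submodule.zero_mem _
  | cons e L ih =>
    have hsplit : (fun g : GLm p m => (certVal (e :: L) (g : Mat p m) : ℂ)) =
        (e.2.2 : ℂ) • (fun g : GLm p m => if (g : Mat p m).mulVec e.1 = e.2.1 then (1 : ℂ) else 0) +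
        (fun g : GLm p m => (certVal L (g : Mat p m) : ℂ)) := by
      funext g
      simp only [certVal_cons, Int.cast_add, Pi.add_apply, Pi.smul_apply, smul_eq_mul]
      split_ifs <;> simp
    rw [hsplit]
    exact Submodule.add_mem _ (Submodule.smul_mem _ _ (entry_mem_levelSubmodule e.1 e.2.1)) ih

/-- **Soundness of a level-one separation certificate (one target).**  If `N ≠ 0` and the integer
frame function of `L` takes the value `N·[x = x₀ ∧ y = y' ∧ z = z₀]` at every quadruple product
`x⁻¹ y y'⁻¹ z` of the triple, then some rank-`≤ 1` Fourier table separates the target `(x₀, z₀)`. -/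
theorem sep_target_of_cert {X Y Z : Finset (GLm p m)} {N : ℤ} {L : List (CertEntry p m)}
    {x₀ z₀ : GLm p m} (hN : N ≠ 0)
    (hval : ∀ x ∈ X, ∀ y ∈ Y, ∀ y' ∈ Y, ∀ z ∈ Z,
      certVal L ((x⁻¹ * y * y'⁻¹ * z : GLm p m) : Mat p m) = if x = x₀ ∧ y = y' ∧ z = z₀ then N else 0) :
    ∃ c : Mat p m → ℂ, RankSupp 1 c ∧ ∀ x ∈ X, ∀ y ∈ Y, ∀ y' ∈ Y, ∀ z ∈ Z,
      fourierFn c (x⁻¹ * y * y'⁻¹ * z) = if x = x₀ ∧ y = y' ∧ z = z₀ then 1 else 0 := by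
  have hmem : (fun g : GLm p m => (N : ℂ)⁻¹ * (certVal L (g : Mat p m) : ℂ)) ∈ levelSubmodule p m 1 :=
    Submodule.smul_mem _ ((N : ℂ)⁻¹) (certVal_mem_levelSubmodule L)
  obtain ⟨c, hc, hfc⟩ := mem_levelSubmodule_iff.mp hmem
  refine ⟨c, hc, fun x hx y hy y' hy' z hz => ?_⟩
  rw [← hfc, hval x hx y hy y' hy' z hz]
  have hN' : (N : ℂ) ≠ 0 := Int.cast_ne_zero.mpr hN
  split_ifs <;> simp [hN']

/-- **Soundness of level-one separation certificates** (generic `GL_m(𝔽_p)` form).  `cert` assigns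
to each target `(x₀, z₀)` a scale and an entry list; if every target passes, `RankSep 1 X Y Z`. -/
theorem rankSep_one_of_cert (X Y Z : Finset (GLm p m))
    (cert : GLm p m → GLm p m → ℤ × List (CertEntry p m))
    (h : ∀ x₀ ∈ X, ∀ z₀ ∈ Z, (cert x₀ z₀).1 ≠ 0 ∧ ∀ x ∈ X, ∀ y ∈ Y, ∀ y' ∈ Y, ∀ z ∈ Z,
      certVal (cert x₀ z₀).2 ((x⁻¹ * y * y'⁻¹ * z : GLm p m) : Mat p m)
        = if x = x₀ ∧ y = y' ∧ z = z₀ then (cert x₀ z₀).1 else 0) :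
    RankSep 1 X Y Z :=
  fun x₀ hx₀ z₀ hz₀ => sep_target_of_cert (h x₀ hx₀ z₀ hz₀).1 (h x₀ hx₀ z₀ hz₀).2

end Generic

/-! ## The fast lane for `GL_2(𝔽_p)`: concrete `2 × 2` matrices as 4-tuples

Compiled evaluation of the generic check is slow (Mathlib matrices are closures; products and
inverses are recomputed at every entry access), so the data files state sets and certificates over
the concrete type `M2 p` and `rankSep_one_of_fastCheck` transports a passing `Bool` check to
`RankSep 1` of the decoded `Finset (GLm p 2)`s. -/

/-- Concrete `2 × 2` matrices over `𝔽_p`: `⟨a, b, c, d⟩ = [[a, b], [c, d]]`. -/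
@[ext] structure M2 (p : ℕ) where
  /-- entry `(0,0)` -/
  a : ZMod p
  /-- entry `(0,1)` -/
  b : ZMod p
  /-- entry `(1,0)` -/
  c : ZMod p
  /-- entry `(1,1)` -/
  d : ZMod p
deriving DecidableEq

section Concrete

variable {p : ℕ}

namespace M2

/-- Determinant. -/
def det (A : M2 p) : ZMod p := A.a * A.d - A.b * A.c

/-- Product. -/
def mul (A B : M2 p) : M2 p :=
  ⟨A.a * B.a + A.b * B.c, A.a * B.b + A.b * B.d, A.c * B.a + A.d * B.c, A.c * B.b + A.d * B.d⟩

/-- Inverse by the adjugate formula (junk if singular). -/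
def inv (A : M2 p) : M2 p :=
  ⟨A.det⁻¹ * A.d, -(A.det⁻¹ * A.b), -(A.det⁻¹ * A.c), A.det⁻¹ * A.a⟩

/-- Action on column vectors `(u₀, u₁)`. -/
def app (A : M2 p) (u : ZMod p × ZMod p) : ZMod p × ZMod p :=
  (A.a * u.1 + A.b * u.2, A.c * u.1 + A.d * u.2)

/-- The Mathlib matrix of a 4-tuple. -/
def toMat (A : M2 p) : Mat p 2 := !![A.a, A.b; A.c, A.d]

/-- `toMat` is multiplicative. -/
theorem toMat_mul (A B : M2 p) : (A.mul B).toMat = A.toMat * B.toMat := by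
  ext i j
  fin_cases i <;> fin_cases j <;> simp [toMat, mul, Matrix.mul_apply, Fin.sum_univ_two]

/-- `toMat` intertwines the action on pairs with `Matrix.mulVec`. -/
theorem toMat_mulVec (A : M2 p) (u : ZMod p × ZMod p) :
    A.toMat.mulVec ![u.1, u.2] = ![(A.app u).1, (A.app u).2] := by
  ext i
  fin_cases i <;> simp [toMat, app, Matrix.mulVec, dotProduct, Fin.sum_univ_two]

/-- `toMat` is injective. -/
theorem toMat_injective : Function.Injective (toMat : M2 p → Mat p 2) := by
  intro A B h
  have h00 := congrFun (congrFun h 0) 0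
  have h01 := congrFun (congrFun h 0) 1
  have h10 := congrFun (congrFun h 1) 0
  have h11 := congrFun (congrFun h 1) 1
  simp [toMat] at h00 h01 h10 h11
  exact M2.ext h00 h01 h10 h11

end M2

/-- Fast certificate entry `((u₀,u₁), (v₀,v₁), a)`: contributes `a·[q u = v]`. -/
abbrev FastEntry (p : ℕ) : Type := (ZMod p × ZMod p) × (ZMod p × ZMod p) × ℤ

/-- Fast integer frame function `Σ a·[q u = v]` on 4-tuples. -/
def fastVal (L : List (FastEntry p)) (q : M2 p) : ℤ :=
  (L.map fun e => if q.app e.1 = e.2.1 then e.2.2 else 0).sum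

/-- Fast certificate table: rows `(x₀, z₀, N, entries)`. -/
abbrev FastTable (p : ℕ) : Type := List (M2 p × M2 p × ℤ × List (FastEntry p))

/-- Row of the target `(x₀, z₀)` (scale `0`, hence a failing check, if absent). -/
def fastLookup (T : FastTable p) (x z : M2 p) : ℤ × List (FastEntry p) :=
  match T.find? (fun r => decide (r.1 = x ∧ r.2.1 = z)) with
  | some r => (r.2.2.1, r.2.2.2)
  | none => (0, [])

/-- Fast check of ONE target `(x₀, z₀)` against scale `N` and entries `L`: `N ≠ 0` and the frame
function equals `N·[x = x₀ ∧ y = y' ∧ z = z₀]` at every quadruple product (as 4-tuples). -/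
def fastTargetCheck (LX LY LZ : List (M2 p)) (N : ℤ) (L : List (FastEntry p)) (x₀ z₀ : M2 p) :
    Bool :=
  (N != 0) &&
    LX.all fun x => LY.all fun y => LY.all fun y' => LZ.all fun z =>
      fastVal L (((x.inv.mul y).mul y'.inv).mul z) == (if x = x₀ ∧ y = y' ∧ z = z₀ then N else 0)

/-- **The fast check** of a whole design (a `Bool`, evaluated by `native_decide` in the data
files): all listed 4-tuples are nonsingular and every target `(x₀, z₀) ∈ LX × LZ` passes
`fastTargetCheck` with its row of the table. -/
def fastCheck (LX LY LZ : List (M2 p)) (T : FastTable p) : Bool :=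
  (LX.all fun x => x.det != 0) && (LY.all fun y => y.det != 0) && (LZ.all fun z => z.det != 0) &&
    LX.all fun x₀ => LZ.all fun z₀ =>
      fastTargetCheck LX LY LZ (fastLookup T x₀ z₀).1 (fastLookup T x₀ z₀).2 x₀ z₀

/-! ### String-coded data (constant elaboration cost; decoded at evaluation time)

Large certificate tables as term literals are expensive to elaborate, so the data files carry them
as ONE string of whitespace-separated integers, decoded by the total functions below.  Soundness is
unaffected: the theorems speak about the decoded lists. Formats: a set is `a b c d a b c d …`
(row-major matrices); a table is a sequence of rows `x₀(4) z₀(4) N k` followed by `k` entries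
`u₀ u₁ v₀ v₁ a`. -/

/-- Tokenizer state: sign seen, inside a number, its value so far, tokens read (reversed). -/
structure TokState where
  /-- a `-` was read since the last separator -/
  neg : Bool
  /-- at least one digit was read since the last separator -/
  inNum : Bool
  /-- value of the digits read so far -/
  val : ℕ
  /-- integers read so far, most recent first -/
  acc : List ℤ

/-- One character of input: digits accumulate, `-` sets the sign, anything else ends the token. -/
def tokStep (st : TokState) (c : Char) : TokState :=
  if c.isDigit then { st with inNum := true, val := st.val * 10 + (c.toNat - 48) }
  else if c = '-' then { st with neg := true }
  else if st.inNum then ⟨false, false, 0, (if st.neg then -(st.val : ℤ) else (st.val : ℤ)) :: st.acc⟩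
  else ⟨false, false, 0, st.acc⟩

/-- All integers in a string of whitespace-separated (optionally signed) decimal numerals. -/
def intsOfString (s : String) : List ℤ :=
  (tokStep (s.foldl tokStep ⟨false, false, 0, []⟩) ' ').acc.reverse

/-- Chunks of four integers as concrete matrices over `𝔽_p` (a trailing incomplete chunk is dropped). -/
def m2sOfInts : List ℤ → List (M2 p)
  | a :: b :: c :: d :: rest => ⟨(a : ZMod p), (b : ZMod p), (c : ZMod p), (d : ZMod p)⟩ :: m2sOfInts rest
  | _ => []

/-- The set coded by a string. -/
def m2sOfString (p : ℕ) (s : String) : List (M2 p) := m2sOfInts (intsOfString s)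

/-- Read `k` entries `u₀ u₁ v₀ v₁ a`; returns the entries and the unread remainder. -/
def entriesOfInts : ℕ → List ℤ → List (FastEntry p) × List ℤ
  | 0, l => ([], l)
  | k + 1, u₀ :: u₁ :: v₀ :: v₁ :: a :: rest =>
      let r := entriesOfInts k rest
      ((((u₀ : ZMod p), (u₁ : ZMod p)), ((v₀ : ZMod p), (v₁ : ZMod p)), a) :: r.1, r.2)
  | _ + 1, l => ([], l)

/-- Read rows `x₀(4) z₀(4) N k entries…` (first argument: fuel). -/
def rowsOfInts : ℕ → List ℤ → FastTable p
  | 0, _ => []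
  | fuel + 1, a :: b :: c :: d :: a' :: b' :: c' :: d' :: N :: k :: rest =>
      let r := entriesOfInts (p := p) k.toNat rest
      (⟨(a : ZMod p), (b : ZMod p), (c : ZMod p), (d : ZMod p)⟩,
        ⟨(a' : ZMod p), (b' : ZMod p), (c' : ZMod p), (d' : ZMod p)⟩, N, r.1) :: rowsOfInts fuel r.2
  | _ + 1, _ => []

/-- The certificate table coded by a string. -/
def tableOfString (p : ℕ) (s : String) : FastTable p :=
  rowsOfInts (intsOfString s).length (intsOfString s)

/-- Conversion of a fast entry to a generic certificate entry (pairs to `Fin 2`-vectors). -/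
def entryOfFast (e : FastEntry p) : CertEntry p 2 := (![e.1.1, e.1.2], ![e.2.1.1, e.2.1.2], e.2.2)

/-- Equality of `Fin 2`-vectors is equality of both coordinates. -/
theorem vec2_eq_iff (a b c d : ZMod p) : (![a, b] : Fin 2 → ZMod p) = ![c, d] ↔ a = c ∧ b = d := by
  constructor
  · intro h
    exact ⟨by simpa using congrFun h 0, by simpa using congrFun h 1⟩
  · rintro ⟨rfl, rfl⟩; rfl

/-- The generic frame function of the converted entries, at the Mathlib matrix of a 4-tuple, is the
fast frame function. -/
theorem certVal_map_entryOfFast (L : List (FastEntry p)) (A : M2 p) :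
    certVal (L.map entryOfFast) A.toMat = fastVal L A := by
  induction L with
  | nil => rfl
  | cons e L ih =>
    have hstep : fastVal (e :: L) A = (if A.app e.1 = e.2.1 then e.2.2 else 0) + fastVal L A := by
      simp [fastVal]
    rw [List.map_cons, certVal_cons, hstep, ih]
    congr 1
    simp only [entryOfFast, M2.toMat_mulVec, vec2_eq_iff]
    by_cases h : A.app e.1 = e.2.1
    · rw [if_pos h, if_pos (by rw [h]; exact ⟨rfl, rfl⟩)]
    · rw [if_neg h, if_neg]
      rintro ⟨h1, h2⟩
      exact h (Prod.ext h1 h2)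

variable [Fact p.Prime]

/-! ### Explicit elements of `GL_2(𝔽_p)` -/

/-- The adjugate identity for `2 × 2` matrices. [folklore] -/
theorem mat2_mul_adj (a b c d : ZMod p) :
    !![a, b; c, d] * !![d, -b; -c, a] = (a * d - b * c) • (1 : Mat p 2) := by
  ext i j
  fin_cases i <;> fin_cases j <;> simp [Matrix.mul_apply, Fin.sum_univ_two] <;> ring

/-- The adjugate identity for `2 × 2` matrices, other order. [folklore] -/
theorem mat2_adj_mul (a b c d : ZMod p) :
    !![d, -b; -c, a] * !![a, b; c, d] = (a * d - b * c) • (1 : Mat p 2) := by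
  ext i j
  fin_cases i <;> fin_cases j <;> simp [Matrix.mul_apply, Fin.sum_univ_two] <;> ring

/-- `[[a, b], [c, d]]` as an element of `GL_2(𝔽_p)`, with its inverse by the adjugate formula. -/
def gl2 (a b c d : ZMod p) (h : a * d - b * c ≠ 0) : GLm p 2 where
  val := !![a, b; c, d]
  inv := (a * d - b * c)⁻¹ • !![d, -b; -c, a]
  val_inv := by
    rw [Matrix.mul_smul, mat2_mul_adj, smul_smul, inv_mul_cancel₀ h, one_smul]
  inv_val := by
    rw [Matrix.smul_mul, mat2_adj_mul, smul_smul, inv_mul_cancel₀ h, one_smul]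

/-- The underlying matrix of `gl2 a b c d h`. -/
@[simp] theorem gl2_val (a b c d : ZMod p) (h : a * d - b * c ≠ 0) :
    ((gl2 a b c d h : GLm p 2) : Mat p 2) = !![a, b; c, d] := rfl

namespace M2

/-- The group element of a nonsingular 4-tuple (the identity if singular). -/
def toGL (A : M2 p) : GLm p 2 :=
  if h : A.a * A.d - A.b * A.c ≠ 0 then gl2 A.a A.b A.c A.d h else 1

/-- The underlying matrix of `toGL` of a nonsingular 4-tuple. -/
theorem val_toGL {A : M2 p} (h : A.det ≠ 0) : ((A.toGL : GLm p 2) : Mat p 2) = A.toMat := by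
  unfold toGL
  rw [dif_pos (by simpa [det] using h)]
  rfl

/-- The underlying matrix of the inverse of `toGL` of a nonsingular 4-tuple is the adjugate inverse. -/
theorem val_toGL_inv {A : M2 p} (h : A.det ≠ 0) :
    ((A.toGL⁻¹ : GLm p 2) : Mat p 2) = A.inv.toMat := by
  unfold toGL
  rw [dif_pos (by simpa [det] using h)]
  show (A.a * A.d - A.b * A.c)⁻¹ • !![A.d, -A.b; -A.c, A.a] = A.inv.toMat
  ext i j
  fin_cases i <;> fin_cases j <;> simp [toMat, inv, det]

/-- `toGL` is injective on nonsingular 4-tuples. -/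
theorem toGL_injective {A B : M2 p} (hA : A.det ≠ 0) (hB : B.det ≠ 0) (h : A.toGL = B.toGL) :
    A = B := by
  apply toMat_injective
  rw [← val_toGL hA, ← val_toGL hB, h]

end M2

/-- The finite set of group elements listed as 4-tuples. -/
def setOfM2 (L : List (M2 p)) : Finset (GLm p 2) := (L.map M2.toGL).toFinset

/-- Membership in a decoded set. -/
theorem mem_setOfM2 {L : List (M2 p)} {g : GLm p 2} : g ∈ setOfM2 L ↔ ∃ A ∈ L, A.toGL = g := by
  simp [setOfM2]

/-- **Soundness of the fast lane**: a passing `fastCheck` gives `RankSep 1` for the decoded sets. -/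
theorem rankSep_one_of_fastCheck (LX LY LZ : List (M2 p)) (T : FastTable p)
    (h : fastCheck LX LY LZ T = true) :
    RankSep 1 (setOfM2 LX) (setOfM2 LY) (setOfM2 LZ) := by
  simp only [fastCheck, fastTargetCheck, Bool.and_eq_true, List.all_eq_true, bne_iff_ne, ne_eq,
    beq_iff_eq] at h
  obtain ⟨⟨⟨hX, hY⟩, hZ⟩, hall⟩ := h
  intro x₀ hx₀ z₀ hz₀
  obtain ⟨A₀, hA₀, rfl⟩ := mem_setOfM2.mp hx₀
  obtain ⟨C₀, hC₀, rfl⟩ := mem_setOfM2.mp hz₀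
  obtain ⟨hN, hval⟩ := hall A₀ hA₀ C₀ hC₀
  refine sep_target_of_cert (N := (fastLookup T A₀ C₀).1)
    (L := ((fastLookup T A₀ C₀).2).map entryOfFast) hN fun x hx y hy y' hy' z hz => ?_
  obtain ⟨A, hA, rfl⟩ := mem_setOfM2.mp hx
  obtain ⟨B, hB, rfl⟩ := mem_setOfM2.mp hy
  obtain ⟨B', hB', rfl⟩ := mem_setOfM2.mp hy'
  obtain ⟨C, hC, rfl⟩ := mem_setOfM2.mp hz
  have hprod : ((A.toGL⁻¹ * B.toGL * B'.toGL⁻¹ * C.toGL : GLm p 2) : Mat p 2) =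
      (((A.inv.mul B).mul B'.inv).mul C).toMat := by
    rw [Units.val_mul, Units.val_mul, Units.val_mul, M2.val_toGL_inv (hX A hA),
      M2.val_toGL (hY B hB), M2.val_toGL_inv (hY B' hB'), M2.val_toGL (hZ C hC), M2.toMat_mul,
      M2.toMat_mul, M2.toMat_mul]
  rw [hprod, certVal_map_entryOfFast, hval A hA B hB B' hB' C hC]
  have e1 : A.toGL = A₀.toGL ↔ A = A₀ :=
    ⟨M2.toGL_injective (hX A hA) (hX A₀ hA₀), fun h => h ▸ rfl⟩
  have e2 : B.toGL = B'.toGL ↔ B = B' :=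
    ⟨M2.toGL_injective (hY B hB) (hY B' hB'), fun h => h ▸ rfl⟩
  have e3 : C.toGL = C₀.toGL ↔ C = C₀ :=
    ⟨M2.toGL_injective (hZ C hC) (hZ C₀ hC₀), fun h => h ▸ rfl⟩
  by_cases hc : A = A₀ ∧ B = B' ∧ C = C₀
  · rw [if_pos hc, if_pos ⟨e1.mpr hc.1, e2.mpr hc.2.1, e3.mpr hc.2.2⟩]
  · rw [if_neg hc, if_neg (fun hh => hc ⟨e1.mp hh.1, e2.mp hh.2.1, e3.mp hh.2.2⟩)]

end Concrete

end Summit.MatrixMultiplication.MatrixMultiplication.Theorems.LevelOneGL2Designs.Negative
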